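import Literature.MathematicalPhysics.QuantumFieldTheory.Balaban1983to89.Beta.RemainderKernelDecay
import Literature.MathematicalPhysics.QuantumFieldTheory.Balaban1983to89.Beta.RemainderKernelPeriodised
import Literature.MathematicalPhysics.QuantumFieldTheory.Balaban1983to89.B12Decay510Window

/-!
# [Balaban1985Variational] Sect. G (184) + (188) + (189) ⇒ the decay of 𝔄₀ = (δ∕δB)𝒜₀, AT THE ℤ^d-KERNEL LEVEL:
# the Neumann series *"(188) and Lemma 2.1"* for two-variable exponentially decaying kernels on `ℤ^d`
# (`Beta.RemainderKernelNeumann`)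

statement-level skeleton of published theorems with citation tags; proofs where landed; nothing here is a claim
about the Yang–Mills mass gap.

HONEST FRAMING (cell rule).  Bookkeeping for the k-uniform remainder chain of row (D4) (`RemainderConst` ⇐ ONE
`ChainTFac190` instance, `Beta.RemainderDecay190`); discharges NOTHING of `BetaPertH`; NOT B12 Thm 2, NOT the continuum
limit, NOT Clay.  Unit `b2b-balaban-beta-an4` gen 97 (BINDER row D4 OWNER; cell pub-balaban).  Imports
`Beta.RemainderKernelDecay` (gen 95: `decay₂_add` ∕ `_smul` ∕ `_mono` ∕ `_compKer` ∕ `_eq182`),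
`Beta.RemainderKernelPeriodised` (gen 95: `isPeriodic₂_compKer`) and `B12Decay510Window` (b03: the lattice constant
`K₁ d a = Σ_{w ∈ ℤ^d} e^{−a|w|₁}`, `l1_sub_triangle`) ONLY; nothing edited.  [folklore] real analysis on `ℤ^d` kernels.

WHY.  On the MODEL road of row (D4) (gen 96: `RemainderDecay190SupNormPieces.letters_of_pieces182`,
`RemainderDecay190Periodised.exists_data190_of_pieces182_cubes_supNorm`, `RemainderDecay190PeriodisedEnd`) the (182)-piece
`a₀` — the ℤ^d kernel whose periodisations are Bałaban's 𝔄₀ = (δ∕δB)𝒜₀ — enters with its two-variable decay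
`Decay₂ a₀ Ca δ₀` as an INPUT, whereas in print ([15] p. 308) that decay is an OUTPUT: *"This inequality* [(189)]*, the
formula (188) and Lemma 2.1 … yield"* (190) — i.e. the decay of 𝔄₀ follows from the linear equation (184)
`(I + G̃W)𝔄₀ = G̃Δ⁽²⁾H₀ − G̃WH₀` (`W = (δ²∕δA′²)V(𝒜₀ + H₀B)`), the boundedness its Neumann-series solution (188) has under
the smallness (186)–(187),
the decay (189) of `W`, and the row sums of [3] Lemma 2.1.  At the level of BLOCK MAJORANTS on one finite geometry this
inference is `B11SectG.neumann_majorant` ∕ `A0_majorant_of_189` (lit-balaban b11 gen 2).  THIS FILE proves it at the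
level the model road consumes — two-variable kernels on `ℤ^d` with `Decay₂` letters, ONE constant and ONE rate for all
volumes — so that the builder's input for the piece `a₀` becomes: the primitive pieces `g̃`, `w`, `Δ⁽²⁾h₀`, `h₀` with
their decay, the kernel identity (184), the sup bound that (188) gives under (186)–(187), a smallness; the ONE unprinted letter left is exactly (189)
(`Decay₂ w θ_W (δ₀∕4)`, cell GAPS G-B11-G2), as in print.

WHAT (all [folklore]).
§1 `tsum_exp_neg_l1_sub` (`Σ_z e^{−a|x−z|₁} = K₁(d,a)`), `summable_exp_neg_l1_sub`, `K₁_anti` (`a ≤ b ⇒ K₁ b ≤ K₁ a`).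
§2 THE ROW ESTIMATE `abs_compKer_le_of_col_le`: if `|k(x,z)| ≤ θe^{−δ|x−z|₁}` and a column obeys the affine-exponential
   bound `|a(z,y)| ≤ αe^{−ρ|z−y|₁} + β` (`0 ≤ ρ < δ`) then `|(k∘a)(x,y)| ≤ θ(αK₁(δ−ρ)e^{−ρ|x−y|₁} + βK₁(δ))` — the
   triangle inequality spends `δ − ρ` of the kernel's rate on the row sum ([3] (2.54) + (2.61) in `ℤ^d` currency:
   `tsum_exp_mul_exp_le`).
§3 **`decay₂_neumann`** — *"(188) and Lemma 2.1"*: `|a| ≤ |s| + |k∘a|` pointwise (either sign of the equation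
   `a = s ∓ k∘a`), `Decay₂ k θ δ`, `Decay₂ s A ρ` (`0 ≤ ρ < δ`), the A-PRIORI sup bound `|a| ≤ M₀` (what (188) delivers under (186)–(187)) and
   `q := θK₁(δ−ρ) < 1` ⟹ `Decay₂ a (A(1−q)⁻¹) ρ`.  Proof: by induction `|a(x,y)| ≤ (Σ_{n<N} qⁿ)Ae^{−ρ|x−y|₁} + qᴺM₀`
   for every `N` (§2 applied to the N-th bound as the column letter), then `N → ∞`; no iterated kernels, no summability
   hypothesis beyond what the decay letters give.
§4 `decay₂_compKer_left` — composition spending the rate of the LEFT factor (`δ′ < δ₁`, `δ′ ≤ δ₂`; companion of gen 95's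
   `decay₂_compKer`, which spends the right factor's), `decay₂_sub`.
§5 THE EXACT EQUATION `a + k∘a = s`: `compKer_sub_right` (linearity in the bounded argument), **`eq_of_fix`** (bounded
   solutions are UNIQUE under `θK₁(δ) < 1` — Neumann with `s = 0`), **`isPeriodic₂_of_fix`** (for jointly `n`-periodic
   `k`, `s` the bounded solution is jointly `n`-periodic — its period shift solves the same equation).
§6 **(184) AT THE KERNEL LEVEL**: `decay₂_of_eq184` (pieces `g̃` (B_G, δ₀), `w` (θ_W, ¼δ₀) = (189), `Δ⁽²⁾h₀` (c_Δ, δ₀),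
   `h₀` (A₀, δ₀) [15] (130)∕(161)∕(73)-type letters; `a₀ + (g̃∘w)∘a₀ = g̃∘Δ⁽²⁾h₀ − (g̃∘w)∘h₀` pointwise; `|a₀| ≤ M₀`;
   `q_G := B_Gθ_WK₁(¾δ₀)·K₁(⅛δ₀) < 1` ⟹ `Decay₂ a₀ (C_𝔄(1−q_G)⁻¹) (δ₀∕8)`, `C_𝔄` written out),
   `isPeriodic₂_of_eq184` (periodic pieces ⟹ periodic `a₀`), and the junction **`decay₂_eq182_of_eq184`** with gen 95's
   `decay₂_eq182`: from the SIX primitive pieces `g̃, w, Δ⁽²⁾h₀, h₀, h, 𝔡` + (184) + (188) the (182)-composite kernel of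
   δ𝓗∕δB decays at rate `δ₀∕32` — the model road's `hdec` with NO decay letter on `a₀`.
WHAT IS *NOT* DONE: (189) itself (the decay of `w`) — author-omitted in print, an INPUT here as there; nothing of Bałaban's
operators is constructed (NODE O); the rates ⅛δ₀ ∕ ¼δ₀ are print's, the halvings below are this file's bookkeeping
choices (any `0 ≤ ρ < δ` is allowed by §3); row D4 class UNCHANGED (instance 0∕1; critical-path width 0 = NODE O; D4
DISCHARGE NO DATE).  No `def`, no named fact, no `sorry`, standard axioms.
HONEST DEPENDENCY: continuum YM on T⁴ ⇐ BetaPertH ∧ nine spine estimates (0/9 proved); BetaPertH ⇐ (D1) ∧ (D4) ∧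
CAP+tail; G-an2-4 gates asym, D1 and NE2/3/4.

Sources: [15] = T. Bałaban, Commun. Math. Phys. **102** (1985) 277–309 [Balaban1985Variational], (182)–(184) p. 307,
(185)–(190) p. 308 (*"Thus Eq. (184) can be solved by the Neumann series expansion"* (188); *"This inequality, the formula
(188) and Lemma 2.1 … yield"* (190)); [3] = T. Bałaban, Commun. Math. Phys. **96** (1984) 223–250
[Balaban1984PropagatorsII], Lemma 2.1 (2.54), (2.61) p. 234; [I] = Commun. Math. Phys. **109** (1987) [Balaban1987RG1],
(5.10) p. 293 (the two-variable decay shape).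
-/

namespace Literature.MathematicalPhysics.QuantumFieldTheory.Balaban1983to89.Beta.RemainderKernelNeumann

open Literature.MathematicalPhysics.QuantumFieldTheory.Balaban1983to89
open Literature.MathematicalPhysics.QuantumFieldTheory.Balaban1983to89.B12Sec2to5 (l1 l1_nonneg summable_exp_neg_l1)
open Literature.MathematicalPhysics.QuantumFieldTheory.Balaban1983to89.B12Decay510Window (K₁ K₁_nonneg l1_sub_triangle)
open Literature.MathematicalPhysics.QuantumFieldTheory.Balaban1983to89.Beta
  (Kernel₂ Decay₂ IsPeriodic₂ compKer imageShift imageShiftEquiv imageShiftEquiv_apply)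
open Literature.MathematicalPhysics.QuantumFieldTheory.Balaban1983to89.Beta.RemainderKernelDecay
  (decay₂_compKer decay₂_mono decay₂_add decay₂_eq182)
open Literature.MathematicalPhysics.QuantumFieldTheory.Balaban1983to89.Beta.RemainderKernelPeriodised (isPeriodic₂_compKer)
open Filter Topology

variable {d : ℕ}

/-! ## §1. The lattice constant `K₁` as a shifted row sum -/

/-- `Σ_z e^{−a|x − z|₁} = K₁(d, a)` — the row sum of the (5.10) majorant does not depend on the base point.
[cite: Balaban1987RG1, (5.10) p.293] -/
theorem tsum_exp_neg_l1_sub (a : ℝ) (x : Fin d → ℤ) :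
    ∑' z : Fin d → ℤ, Real.exp (-a * l1 (x - z)) = K₁ d a := by
  have h := (Equiv.subLeft x).tsum_eq (fun w : Fin d → ℤ => Real.exp (-a * l1 w))
  simp only [Equiv.subLeft_apply] at h
  unfold K₁
  exact h

/-- The shifted row `z ↦ e^{−a|x − z|₁}` of the (5.10) majorant is summable for `a > 0`.
[cite: Balaban1987RG1, (5.10) p.293] -/
theorem summable_exp_neg_l1_sub {a : ℝ} (ha : 0 < a) (x : Fin d → ℤ) :
    Summable fun z : Fin d → ℤ => Real.exp (-a * l1 (x - z)) := by
  have e : (fun z : Fin d → ℤ => Real.exp (-a * l1 (x - z))) =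
      (fun w : Fin d → ℤ => Real.exp (-a * l1 w)) ∘ (Equiv.subLeft x) := by
    funext z; simp
  rw [e, Equiv.summable_iff]
  exact summable_exp_neg_l1 ha d

/-- The (5.10) lattice constant `K₁` is antitone in the rate: `0 < a ≤ b ⇒ K₁(b) ≤ K₁(a)`.
[cite: Balaban1987RG1, (5.10) p.293] -/
theorem K₁_anti {a b : ℝ} (ha : 0 < a) (hab : a ≤ b) : K₁ d b ≤ K₁ d a := by
  unfold K₁
  refine Summable.tsum_le_tsum (fun z => Real.exp_le_exp.mpr ?_) (summable_exp_neg_l1 (ha.trans_le hab) d)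
    (summable_exp_neg_l1 ha d)
  have := l1_nonneg z
  nlinarith

/-! ## §2. The row estimate: a decaying kernel against an affine-exponential column bound -/

/-- Triangle inequality in the exponent: `e^{−δ|x−z|₁}e^{−ρ|z−y|₁} ≤ e^{−(δ−ρ)|x−z|₁}e^{−ρ|x−y|₁}` (`ρ ≥ 0`).
[cite: Balaban1984PropagatorsII, (2.54) p.234] -/
theorem exp_mul_exp_le {δ ρ : ℝ} (hρ : 0 ≤ ρ) (x y z : Fin d → ℤ) :
    Real.exp (-δ * l1 (x - z)) * Real.exp (-ρ * l1 (z - y)) ≤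
      Real.exp (-(δ - ρ) * l1 (x - z)) * Real.exp (-ρ * l1 (x - y)) := by
  rw [← Real.exp_add, ← Real.exp_add]
  refine Real.exp_le_exp.mpr ?_
  have ht := mul_le_mul_of_nonneg_left (l1_sub_triangle x z y) hρ
  rw [mul_add] at ht
  linarith

/-- The summed form: `Σ_z e^{−δ|x−z|₁}e^{−ρ|z−y|₁} ≤ K₁(δ−ρ)·e^{−ρ|x−y|₁}` for `0 ≤ ρ < δ` — (2.54) + (2.61) in `ℤ^d`
currency. [cite: Balaban1984PropagatorsII, (2.54) and (2.61) p.234] -/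
theorem tsum_exp_mul_exp_le {δ ρ : ℝ} (hρ : 0 ≤ ρ) (hρδ : ρ < δ) (x y : Fin d → ℤ) :
    ∑' z : Fin d → ℤ, Real.exp (-δ * l1 (x - z)) * Real.exp (-ρ * l1 (z - y)) ≤
      K₁ d (δ - ρ) * Real.exp (-ρ * l1 (x - y)) := by
  have hs : Summable fun z : Fin d → ℤ =>
      Real.exp (-(δ - ρ) * l1 (x - z)) * Real.exp (-ρ * l1 (x - y)) :=
    (summable_exp_neg_l1_sub (by linarith) x).mul_right _
  have hf : Summable fun z : Fin d → ℤ => Real.exp (-δ * l1 (x - z)) * Real.exp (-ρ * l1 (z - y)) :=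
    Summable.of_nonneg_of_le (fun _ => by positivity) (fun z => exp_mul_exp_le hρ x y z) hs
  calc ∑' z : Fin d → ℤ, Real.exp (-δ * l1 (x - z)) * Real.exp (-ρ * l1 (z - y))
      ≤ ∑' z : Fin d → ℤ, Real.exp (-(δ - ρ) * l1 (x - z)) * Real.exp (-ρ * l1 (x - y)) :=
        hf.tsum_le_tsum (fun z => exp_mul_exp_le hρ x y z) hs
    _ = K₁ d (δ - ρ) * Real.exp (-ρ * l1 (x - y)) := by
        rw [tsum_mul_right, tsum_exp_neg_l1_sub]

/-- The summability behind §2: the row `z ↦ e^{−δ|x−z|₁}e^{−ρ|z−y|₁}` is summable for `0 ≤ ρ < δ`.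
[cite: Balaban1984PropagatorsII, (2.54) and (2.61) p.234] -/
theorem summable_exp_mul_exp {δ ρ : ℝ} (hρ : 0 ≤ ρ) (hρδ : ρ < δ) (x y : Fin d → ℤ) :
    Summable fun z : Fin d → ℤ => Real.exp (-δ * l1 (x - z)) * Real.exp (-ρ * l1 (z - y)) :=
  Summable.of_nonneg_of_le (fun _ => by positivity) (fun z => exp_mul_exp_le hρ x y z)
    ((summable_exp_neg_l1_sub (by linarith) x).mul_right _)

/-- **THE ROW ESTIMATE.**  `|k(x,z)| ≤ θe^{−δ|x−z|₁}` and the COLUMN letter `|a(z,y)| ≤ αe^{−ρ|z−y|₁} + β` for all `z`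
(`0 ≤ ρ < δ`, `α ≥ 0`) give `|(k∘a)(x,y)| ≤ θ·(αK₁(δ−ρ)e^{−ρ|x−y|₁} + βK₁(δ))`; the composition series converges
absolutely. [cite: Balaban1985Variational, (188) p.308; Balaban1984PropagatorsII, Lemma 2.1 p.234] -/
theorem abs_compKer_le_of_col_le {k a : Kernel₂ d} {θ δ ρ α β : ℝ} (hk : Decay₂ k θ δ) (hρ : 0 ≤ ρ) (hρδ : ρ < δ)
    (hα : 0 ≤ α) (y : Fin d → ℤ)
    (ha : ∀ z, |a z y| ≤ α * Real.exp (-ρ * l1 (z - y)) + β) (x : Fin d → ℤ) :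
    |compKer k a x y| ≤ θ * (α * K₁ d (δ - ρ) * Real.exp (-ρ * l1 (x - y)) + β * K₁ d δ) := by
  have hθ : 0 ≤ θ := hk.constant_nonneg
  have hδ : 0 < δ := lt_of_le_of_lt hρ hρδ
  -- the termwise majorant
  have hdom : ∀ z, |k x z * a z y| ≤
      θ * α * (Real.exp (-δ * l1 (x - z)) * Real.exp (-ρ * l1 (z - y))) +
        θ * β * Real.exp (-δ * l1 (x - z)) := by
    intro z
    rw [abs_mul]
    have e0 : 0 ≤ Real.exp (-δ * l1 (x - z)) := (Real.exp_pos _).le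
    calc |k x z| * |a z y|
        ≤ (θ * Real.exp (-δ * l1 (x - z))) * (α * Real.exp (-ρ * l1 (z - y)) + β) :=
          mul_le_mul (hk x z) (ha z) (abs_nonneg _) (mul_nonneg hθ e0)
      _ = _ := by ring
  have hs1 := summable_exp_mul_exp hρ hρδ x y
  have hs2 := summable_exp_neg_l1_sub hδ x
  have hmaj : Summable fun z : Fin d → ℤ =>
      θ * α * (Real.exp (-δ * l1 (x - z)) * Real.exp (-ρ * l1 (z - y))) +
        θ * β * Real.exp (-δ * l1 (x - z)) := (hs1.mul_left _).add (hs2.mul_left _)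
  have habs : Summable fun z => |k x z * a z y| :=
    Summable.of_nonneg_of_le (fun _ => abs_nonneg _) hdom hmaj
  have hsum : Summable fun z => k x z * a z y :=
    Summable.of_norm (by simpa only [Real.norm_eq_abs] using habs)
  unfold compKer
  calc |∑' z, k x z * a z y| ≤ ∑' z, |k x z * a z y| := by
        have h := norm_tsum_le_tsum_norm hsum.norm
        simpa only [Real.norm_eq_abs] using h
    _ ≤ ∑' z, (θ * α * (Real.exp (-δ * l1 (x - z)) * Real.exp (-ρ * l1 (z - y))) +
          θ * β * Real.exp (-δ * l1 (x - z))) := habs.tsum_le_tsum hdom hmaj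
    _ = θ * α * ∑' z, Real.exp (-δ * l1 (x - z)) * Real.exp (-ρ * l1 (z - y)) +
          θ * β * ∑' z, Real.exp (-δ * l1 (x - z)) := by
        rw [Summable.tsum_add (hs1.mul_left _) (hs2.mul_left _), tsum_mul_left, tsum_mul_left]
    _ ≤ θ * α * (K₁ d (δ - ρ) * Real.exp (-ρ * l1 (x - y))) + θ * β * K₁ d δ := by
        refine add_le_add (mul_le_mul_of_nonneg_left (tsum_exp_mul_exp_le hρ hρδ x y) (mul_nonneg hθ hα)) ?_
        rw [tsum_exp_neg_l1_sub]
    _ = θ * (α * K₁ d (δ - ρ) * Real.exp (-ρ * l1 (x - y)) + β * K₁ d δ) := by ring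

/-! ## §3. *"(188) and Lemma 2.1"*: the Neumann series gives the decay of the solution -/

/-- **THE NEUMANN SERIES FOR DECAYING `ℤ^d` KERNELS** ([15] p. 308, *"(188) and Lemma 2.1"*).  Let `a`, `s`, `k` be
two-variable kernels on `ℤ^d` with `|a(x,y)| ≤ |s(x,y)| + |(k∘a)(x,y)|` (the solution of `a = s ∓ k∘a` — (184) with
`k = ±G̃W`, `s = G̃Δ⁽²⁾H₀ − G̃WH₀`), `|k(x,y)| ≤ θe^{−δ|x−y|₁}`, `|s(x,y)| ≤ Ae^{−ρ|x−y|₁}` with `0 ≤ ρ < δ`, and let `a` be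
A PRIORI BOUNDED, `|a(x,y)| ≤ M₀` (what the norm convergence (188) of the Neumann series gives).  If
`q := θ·K₁(d, δ−ρ) < 1` then `|a(x,y)| ≤ A(1−q)⁻¹e^{−ρ|x−y|₁}`.  Proof: for every `N`,
`|a(x,y)| ≤ (Σ_{n<N} qⁿ)Ae^{−ρ|x−y|₁} + qᴺM₀` by induction on `N` (the `N`-th bound is a column letter for the row
estimate `abs_compKer_le_of_col_le`, and `θK₁(δ) ≤ q`); let `N → ∞`.
[cite: Balaban1985Variational, (184) p.307 and (188) p.308; Balaban1984PropagatorsII, Lemma 2.1 (2.54), (2.61) p.234] -/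
theorem decay₂_neumann {k s a : Kernel₂ d} {θ A M₀ δ ρ : ℝ}
    (hk : Decay₂ k θ δ) (hs : Decay₂ s A ρ) (hM₀ : ∀ x y, |a x y| ≤ M₀)
    (hρ : 0 ≤ ρ) (hρδ : ρ < δ)
    (hfix : ∀ x y, |a x y| ≤ |s x y| + |compKer k a x y|)
    (hq : θ * K₁ d (δ - ρ) < 1) :
    Decay₂ a (A * (1 - θ * K₁ d (δ - ρ))⁻¹) ρ := by
  have hθ : 0 ≤ θ := hk.constant_nonneg
  have hA : 0 ≤ A := hs.constant_nonneg
  have hM : 0 ≤ M₀ := (abs_nonneg _).trans (hM₀ 0 0)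
  have hq0 : 0 ≤ θ * K₁ d (δ - ρ) := mul_nonneg hθ (K₁_nonneg _ _)
  have hKδ : θ * K₁ d δ ≤ θ * K₁ d (δ - ρ) :=
    mul_le_mul_of_nonneg_left (K₁_anti (by linarith) (by linarith)) hθ
  -- the N-th Neumann bound, for every N
  have hN : ∀ N : ℕ, ∀ x y, |a x y| ≤
      (∑ n ∈ Finset.range N, (θ * K₁ d (δ - ρ)) ^ n) * A * Real.exp (-ρ * l1 (x - y)) +
        (θ * K₁ d (δ - ρ)) ^ N * M₀ := by
    intro N
    induction N with
    | zero =>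
        intro x y
        simpa using hM₀ x y
    | succ N ih =>
        intro x y
        have hS0 : 0 ≤ ∑ n ∈ Finset.range N, (θ * K₁ d (δ - ρ)) ^ n :=
          Finset.sum_nonneg fun n _ => pow_nonneg hq0 n
        have hcol : ∀ z, |a z y| ≤ (∑ n ∈ Finset.range N, (θ * K₁ d (δ - ρ)) ^ n) * A *
            Real.exp (-ρ * l1 (z - y)) + (θ * K₁ d (δ - ρ)) ^ N * M₀ := fun z => ih z y
        have hrow := abs_compKer_le_of_col_le hk hρ hρδ (mul_nonneg hS0 hA) y hcol x
        have hrem : θ * K₁ d δ * ((θ * K₁ d (δ - ρ)) ^ N * M₀) ≤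
            θ * K₁ d (δ - ρ) * ((θ * K₁ d (δ - ρ)) ^ N * M₀) :=
          mul_le_mul_of_nonneg_right hKδ (mul_nonneg (pow_nonneg hq0 N) hM)
        have hsum : ∑ n ∈ Finset.range (N + 1), (θ * K₁ d (δ - ρ)) ^ n =
            1 + θ * K₁ d (δ - ρ) * ∑ n ∈ Finset.range N, (θ * K₁ d (δ - ρ)) ^ n := by
          rw [Finset.mul_sum, Finset.sum_range_succ']
          simp only [pow_succ', pow_zero]
          ring
        calc |a x y| ≤ |s x y| + |compKer k a x y| := hfix x y
          _ ≤ A * Real.exp (-ρ * l1 (x - y)) +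
              θ * ((∑ n ∈ Finset.range N, (θ * K₁ d (δ - ρ)) ^ n) * A * K₁ d (δ - ρ) *
                Real.exp (-ρ * l1 (x - y)) + (θ * K₁ d (δ - ρ)) ^ N * M₀ * K₁ d δ) := add_le_add (hs x y) hrow
          _ = (1 + θ * K₁ d (δ - ρ) * ∑ n ∈ Finset.range N, (θ * K₁ d (δ - ρ)) ^ n) * A *
                Real.exp (-ρ * l1 (x - y)) + θ * K₁ d δ * ((θ * K₁ d (δ - ρ)) ^ N * M₀) := by ring
          _ ≤ (1 + θ * K₁ d (δ - ρ) * ∑ n ∈ Finset.range N, (θ * K₁ d (δ - ρ)) ^ n) * A *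
                Real.exp (-ρ * l1 (x - y)) + θ * K₁ d (δ - ρ) * ((θ * K₁ d (δ - ρ)) ^ N * M₀) := by
              linarith
          _ = (∑ n ∈ Finset.range (N + 1), (θ * K₁ d (δ - ρ)) ^ n) * A * Real.exp (-ρ * l1 (x - y)) +
                (θ * K₁ d (δ - ρ)) ^ (N + 1) * M₀ := by
              rw [hsum, pow_succ']
              ring
  -- N → ∞
  intro x y
  have hgeom : HasSum (fun n : ℕ => (θ * K₁ d (δ - ρ)) ^ n) (1 - θ * K₁ d (δ - ρ))⁻¹ :=
    hasSum_geometric_of_lt_one hq0 hq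
  have hlim : Tendsto (fun N : ℕ =>
      (∑ n ∈ Finset.range N, (θ * K₁ d (δ - ρ)) ^ n) * A * Real.exp (-ρ * l1 (x - y)) +
        (θ * K₁ d (δ - ρ)) ^ N * M₀) atTop
      (𝓝 ((1 - θ * K₁ d (δ - ρ))⁻¹ * A * Real.exp (-ρ * l1 (x - y)) + 0 * M₀)) :=
    ((hgeom.tendsto_sum_nat.mul_const A).mul_const _).add
      ((tendsto_pow_atTop_nhds_zero_of_lt_one hq0 hq).mul_const M₀)
  rw [zero_mul, add_zero] at hlim
  have h := ge_of_tendsto' hlim (fun N => hN N x y)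
  calc |a x y| ≤ (1 - θ * K₁ d (δ - ρ))⁻¹ * A * Real.exp (-ρ * l1 (x - y)) := h
    _ = A * (1 - θ * K₁ d (δ - ρ))⁻¹ * Real.exp (-ρ * l1 (x - y)) := by ring

/-! ## §4. Composition spending the LEFT factor's rate; differences -/

/-- **TWO-VARIABLE DECAY IS PRESERVED BY COMPOSITION, the row sum taken from the LEFT factor**: if
`|T(x,z)| ≤ C₁e^{−δ₁|x−z|₁}`, `|S(z,y)| ≤ C₂e^{−δ₂|z−y|₁}` then for `0 ≤ δ′ < δ₁`, `δ′ ≤ δ₂`: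
`|(T∘S)(x,y)| ≤ C₁C₂K₁(δ₁−δ′)·e^{−δ′|x−y|₁}` (companion of `RemainderKernelDecay.decay₂_compKer`, which takes the row sum
from the right factor: `δ′ ≤ δ₁`, `δ′ < δ₂`). [cite: Balaban1984PropagatorsII, (2.54) and (2.61) p.234; Balaban1987RG1, (5.10) p.293] -/
theorem decay₂_compKer_left {T S : Kernel₂ d} {C₁ C₂ δ₁ δ₂ δ' : ℝ} (hT : Decay₂ T C₁ δ₁) (hS : Decay₂ S C₂ δ₂)
    (hδ'0 : 0 ≤ δ') (hδ'1 : δ' < δ₁) (hδ'2 : δ' ≤ δ₂) :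
    Decay₂ (compKer T S) (C₁ * C₂ * K₁ d (δ₁ - δ')) δ' := by
  intro x y
  have hS' : Decay₂ S C₂ δ' := decay₂_mono hS hδ'2
  have hcol : ∀ z, |S z y| ≤ C₂ * Real.exp (-δ' * l1 (z - y)) + 0 := fun z => by
    rw [add_zero]; exact hS' z y
  have h := abs_compKer_le_of_col_le hT hδ'0 hδ'1 hS.constant_nonneg y hcol x
  calc |compKer T S x y| ≤ C₁ * (C₂ * K₁ d (δ₁ - δ') * Real.exp (-δ' * l1 (x - y)) + 0 * K₁ d δ₁) := h
    _ = C₁ * C₂ * K₁ d (δ₁ - δ') * Real.exp (-δ' * l1 (x - y)) := by ring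

/-- Decay constants add under pointwise differences (common rate). [cite: Balaban1987RG1, (5.10) p.293] -/
theorem decay₂_sub {T S : Kernel₂ d} {C₁ C₂ δ : ℝ} (hT : Decay₂ T C₁ δ) (hS : Decay₂ S C₂ δ) :
    Decay₂ (fun x y => T x y - S x y) (C₁ + C₂) δ := fun x y => by
  rw [add_mul]
  exact (abs_sub _ _).trans (add_le_add (hT x y) (hS x y))

/-! ## §5. The exact equation `a + k∘a = s`: linearity, uniqueness and periodicity of the bounded solution -/

/-- The composition series of a decaying kernel against a BOUNDED column converges absolutely — the operator G̃W of
(184) applied to the bounded 𝔄₀ of (188). [cite: Balaban1985Variational, (184) p.307 and (188) p.308] -/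
theorem summable_mul_of_col_bounded {k a : Kernel₂ d} {θ δ M : ℝ} (hk : Decay₂ k θ δ) (hδ : 0 < δ)
    (y : Fin d → ℤ) (ha : ∀ z, |a z y| ≤ M) (x : Fin d → ℤ) : Summable fun z => k x z * a z y := by
  have hθ : 0 ≤ θ := hk.constant_nonneg
  have hM : 0 ≤ M := (abs_nonneg _).trans (ha x)
  have hdom : ∀ z, |k x z * a z y| ≤ θ * M * Real.exp (-δ * l1 (x - z)) := fun z => by
    rw [abs_mul]
    calc |k x z| * |a z y| ≤ (θ * Real.exp (-δ * l1 (x - z))) * M :=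
          mul_le_mul (hk x z) (ha z) (abs_nonneg _) (mul_nonneg hθ (Real.exp_pos _).le)
      _ = θ * M * Real.exp (-δ * l1 (x - z)) := by ring
  have habs : Summable fun z => |k x z * a z y| :=
    Summable.of_nonneg_of_le (fun _ => abs_nonneg _) hdom ((summable_exp_neg_l1_sub hδ x).mul_left _)
  exact Summable.of_norm (by simpa only [Real.norm_eq_abs] using habs)

/-- `k∘(a − b) = k∘a − k∘b` entrywise, for a decaying `k` and BOUNDED `a`, `b` (linearity of the operator of (184) on
bounded kernels). [cite: Balaban1985Variational, (184) p.307] -/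
theorem compKer_sub_right {k a b : Kernel₂ d} {θ δ Ma Mb : ℝ} (hk : Decay₂ k θ δ) (hδ : 0 < δ)
    (ha : ∀ x y, |a x y| ≤ Ma) (hb : ∀ x y, |b x y| ≤ Mb) (x y : Fin d → ℤ) :
    compKer k (fun u v => a u v - b u v) x y = compKer k a x y - compKer k b x y := by
  unfold compKer
  rw [← Summable.tsum_sub (summable_mul_of_col_bounded hk hδ y (fun z => ha z y) x)
    (summable_mul_of_col_bounded hk hδ y (fun z => hb z y) x)]
  exact tsum_congr fun z => by ring

/-- **UNIQUENESS OF THE BOUNDED SOLUTION** of `a + k∘a = s` under `θK₁(δ) < 1` (`|k| ≤ θe^{−δ|·|₁}`, `δ > 0`): two bounded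
solutions coincide — their difference solves the equation with `s = 0` and `decay₂_neumann` at `ρ = 0` gives the
majorant `0`. [cite: Balaban1985Variational, (184) p.307 and (188) p.308] -/
theorem eq_of_fix {k s a b : Kernel₂ d} {θ δ Ma Mb : ℝ} (hk : Decay₂ k θ δ) (hδ : 0 < δ)
    (ha : ∀ x y, |a x y| ≤ Ma) (hb : ∀ x y, |b x y| ≤ Mb)
    (hfa : ∀ x y, a x y + compKer k a x y = s x y) (hfb : ∀ x y, b x y + compKer k b x y = s x y)
    (hq : θ * K₁ d δ < 1) : a = b := by
  have hMa : 0 ≤ Ma := (abs_nonneg _).trans (ha 0 0)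
  have hMb : 0 ≤ Mb := (abs_nonneg _).trans (hb 0 0)
  -- the difference is bounded and solves the homogeneous equation
  have hu : ∀ x y, |a x y - b x y| ≤ Ma + Mb := fun x y =>
    (abs_sub _ _).trans (add_le_add (ha x y) (hb x y))
  have hfix : ∀ x y, |(fun u v => a u v - b u v) x y| ≤
      |(0 : Kernel₂ d) x y| + |compKer k (fun u v => a u v - b u v) x y| := by
    intro x y
    rw [compKer_sub_right hk hδ ha hb]
    have e : a x y - b x y = -(compKer k a x y - compKer k b x y) := by
      linear_combination hfa x y - hfb x y
    show |a x y - b x y| ≤ |(0 : ℝ)| + |compKer k a x y - compKer k b x y|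
    rw [e, abs_neg, abs_zero, zero_add]
  have h0 : Decay₂ (0 : Kernel₂ d) 0 0 := fun x y => by simp
  have hq' : θ * K₁ d (δ - 0) < 1 := by rwa [sub_zero]
  have h := decay₂_neumann hk h0 hu le_rfl hδ hfix hq'
  funext x y
  have e := h x y
  rw [zero_mul, zero_mul] at e
  exact sub_eq_zero.mp (abs_nonpos_iff.mp e)

/-- **PERIODICITY OF THE BOUNDED SOLUTION**: if `k` and `s` are jointly `n·ℤ^d`-periodic, `a` is a bounded solution of
`a + k∘a = s` and `θK₁(δ) < 1`, then `a` is jointly `n·ℤ^d`-periodic — the period shift of `a` is another bounded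
solution (re-index the composition series by the shift), so it equals `a` — block-periodic operators have block-periodic
Neumann solutions. [cite: Balaban1985Variational, (184) p.307 and (188) p.308] -/
theorem isPeriodic₂_of_fix {k s a : Kernel₂ d} {θ δ M : ℝ} {n : ℕ} (hk : Decay₂ k θ δ) (hδ : 0 < δ)
    (pk : IsPeriodic₂ n k) (ps : IsPeriodic₂ n s) (ha : ∀ x y, |a x y| ≤ M)
    (hfa : ∀ x y, a x y + compKer k a x y = s x y) (hq : θ * K₁ d δ < 1) : IsPeriodic₂ n a := by
  intro x y m
  -- the shifted kernel
  have hb : ∀ u v, |(fun u v => a (imageShift n u m) (imageShift n v m)) u v| ≤ M := fun u v => ha _ _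
  have hshift : ∀ u v, compKer k (fun u v => a (imageShift n u m) (imageShift n v m)) u v =
      compKer k a (imageShift n u m) (imageShift n v m) := by
    intro u v
    show (∑' z, k u z * a (imageShift n z m) (imageShift n v m)) =
      ∑' z, k (imageShift n u m) z * a z (imageShift n v m)
    rw [← (imageShiftEquiv n m).tsum_eq (fun z => k (imageShift n u m) z * a z (imageShift n v m))]
    exact tsum_congr fun z => by rw [imageShiftEquiv_apply, pk u z m]
  have hfb : ∀ u v, (fun u v => a (imageShift n u m) (imageShift n v m)) u v +
      compKer k (fun u v => a (imageShift n u m) (imageShift n v m)) u v = s u v := by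
    intro u v
    rw [hshift, ← ps u v m]
    exact hfa _ _
  have e := eq_of_fix hk hδ hb ha hfb hfa hq
  exact congrFun (congrFun e x) y

/-! ## §6. (184) at the kernel level: the decay and periodicity of the piece `a₀`, and the (182) junction -/

/-- **(184) + (188) + (189) ⇒ THE DECAY OF 𝔄₀, AT THE ℤ^d-KERNEL LEVEL.**  Pieces: `g̃` with `|g̃| ≤ B_Ge^{−δ₀|·|₁}`
([15] (130)-type), `w` = the kernel (δ²∕δA′²)V(𝒜₀ + H₀B) with `|w| ≤ θ_We^{−¼δ₀|·|₁}` — **(189), the author-omitted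
INPUT** —, `Δ⁽²⁾h₀` (`c_Δ`, `δ₀`), `h₀` (`A₀`, `δ₀`); the SUBJECT `a₀` with the kernel identity (184)
`a₀ + (g̃∘w)∘a₀ = g̃∘Δ⁽²⁾h₀ − (g̃∘w)∘h₀` and the a-priori bound `|a₀| ≤ M₀` (what the Neumann series (188) gives under
(186)–(187)); smallness
`q_G := B_Gθ_WK₁(δ₀ − ¼δ₀)·K₁(¼δ₀ − ⅛δ₀) < 1` ((187)).  THEN `|a₀(x,y)| ≤ C_𝔄(1 − q_G)⁻¹e^{−⅛δ₀|x−y|₁}` with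
`C_𝔄 = B_Gc_ΔK₁(δ₀ − ⅛δ₀) + B_Gθ_WK₁(δ₀ − ¼δ₀)·A₀·K₁(¼δ₀ − ⅛δ₀)` — `decay₂_neumann` with `k = g̃∘w` (rate ¼δ₀,
`decay₂_compKer_left`) and `s = g̃∘Δ⁽²⁾h₀ − (g̃∘w)∘h₀` (rate ⅛δ₀).  The ℤ^d twin of `B11SectG.A0_majorant_of_189`.
[cite: Balaban1985Variational, (184) p.307, (187)–(189) p.308; Balaban1984PropagatorsII, Lemma 2.1 p.234] -/
theorem decay₂_of_eq184 {gt w d2h0 h0 a0 : Kernel₂ d} {BG θW cΔ A₀ M₀ δ₀ : ℝ}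
    (hgt : Decay₂ gt BG δ₀) (hw : Decay₂ w θW (δ₀ / 4)) (hd2 : Decay₂ d2h0 cΔ δ₀) (hh0 : Decay₂ h0 A₀ δ₀)
    (hδ₀ : 0 < δ₀) (hM₀ : ∀ x y, |a0 x y| ≤ M₀)
    (h184 : ∀ x y, a0 x y + compKer (compKer gt w) a0 x y = compKer gt d2h0 x y - compKer (compKer gt w) h0 x y)
    (hq : BG * θW * K₁ d (δ₀ - δ₀ / 4) * K₁ d (δ₀ / 4 - δ₀ / 8) < 1) :
    Decay₂ a0 ((BG * cΔ * K₁ d (δ₀ - δ₀ / 8) + BG * θW * K₁ d (δ₀ - δ₀ / 4) * A₀ * K₁ d (δ₀ / 4 - δ₀ / 8)) *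
      (1 - BG * θW * K₁ d (δ₀ - δ₀ / 4) * K₁ d (δ₀ / 4 - δ₀ / 8))⁻¹) (δ₀ / 8) := by
  -- the kernel K = g̃∘w at rate ¼δ₀, the right-hand side at rate ⅛δ₀
  have hK : Decay₂ (compKer gt w) (BG * θW * K₁ d (δ₀ - δ₀ / 4)) (δ₀ / 4) :=
    decay₂_compKer_left hgt hw (by linarith) (by linarith) le_rfl
  have hs1 : Decay₂ (compKer gt d2h0) (BG * cΔ * K₁ d (δ₀ - δ₀ / 8)) (δ₀ / 8) :=
    decay₂_compKer_left hgt hd2 (by linarith) (by linarith) (by linarith)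
  have hs2 : Decay₂ (compKer (compKer gt w) h0)
      (BG * θW * K₁ d (δ₀ - δ₀ / 4) * A₀ * K₁ d (δ₀ / 4 - δ₀ / 8)) (δ₀ / 8) :=
    decay₂_compKer_left hK hh0 (by linarith) (by linarith) (by linarith)
  have hs := decay₂_sub hs1 hs2
  have hfix : ∀ x y, |a0 x y| ≤ |(fun x y => compKer gt d2h0 x y - compKer (compKer gt w) h0 x y) x y| +
      |compKer (compKer gt w) a0 x y| := by
    intro x y
    have e : a0 x y = (compKer gt d2h0 x y - compKer (compKer gt w) h0 x y) - compKer (compKer gt w) a0 x y := by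
      linear_combination h184 x y
    rw [e]
    exact abs_sub _ _
  exact decay₂_neumann hK hs hM₀ (by linarith) (by linarith) hfix hq

/-- **PERIODIC PIECES ⇒ PERIODIC 𝔄₀**: if `g̃`, `w`, `Δ⁽²⁾h₀`, `h₀` are jointly `n·ℤ^d`-periodic (block-periodic operators of
one torus family), the bounded solution `a₀` of (184) is jointly `n·ℤ^d`-periodic, under the smallness
`B_Gθ_WK₁(δ₀ − ¼δ₀)·K₁(¼δ₀) < 1` — the periodicity letter `pa` of the model road's piece `a₀` from the primitive
pieces. [cite: Balaban1985Variational, (184) p.307 and (188) p.308] -/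
theorem isPeriodic₂_of_eq184 {gt w d2h0 h0 a0 : Kernel₂ d} {BG θW M₀ δ₀ : ℝ} {n : ℕ}
    (hgt : Decay₂ gt BG δ₀) (hw : Decay₂ w θW (δ₀ / 4)) (hδ₀ : 0 < δ₀)
    (pgt : IsPeriodic₂ n gt) (pw : IsPeriodic₂ n w) (pd2 : IsPeriodic₂ n d2h0) (ph0 : IsPeriodic₂ n h0)
    (hM₀ : ∀ x y, |a0 x y| ≤ M₀)
    (h184 : ∀ x y, a0 x y + compKer (compKer gt w) a0 x y = compKer gt d2h0 x y - compKer (compKer gt w) h0 x y)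
    (hq : BG * θW * K₁ d (δ₀ - δ₀ / 4) * K₁ d (δ₀ / 4) < 1) : IsPeriodic₂ n a0 := by
  have hK : Decay₂ (compKer gt w) (BG * θW * K₁ d (δ₀ - δ₀ / 4)) (δ₀ / 4) :=
    decay₂_compKer_left hgt hw (by linarith) (by linarith) le_rfl
  have pK : IsPeriodic₂ n (compKer gt w) := isPeriodic₂_compKer pgt pw
  have ps : IsPeriodic₂ n (fun x y => compKer gt d2h0 x y - compKer (compKer gt w) h0 x y) := fun x y m => by
    show compKer gt d2h0 _ _ - compKer (compKer gt w) h0 _ _ = compKer gt d2h0 x y - compKer (compKer gt w) h0 x y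
    rw [isPeriodic₂_compKer pgt pd2 x y m, isPeriodic₂_compKer pK ph0 x y m]
  exact isPeriodic₂_of_fix hK (by linarith) pK ps hM₀ h184 hq

/-- **THE (182) JUNCTION: `hdec` for δ𝓗∕δB from the SIX primitive pieces, NO decay letter on `a₀`.**  With `a₀` as in
`decay₂_of_eq184` and the pieces `h₀` (`A₀`), `h` (`C_h`), `𝔡` (`C_𝔡`) of (182) decaying at `δ₀` (weakened to the
common rate `⅛δ₀` of `a₀`), gen 95's `RemainderKernelDecay.decay₂_eq182` gives the decay of the (182)-composite kernel
`(a₀ + h₀) − h∘(𝔡∘(a₀ + h₀))` at rate `δ₀∕32` with the constant written out — the letter the model road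
(`RemainderDecay190SupNormPieces.letters_of_pieces182` at common rate `⅛δ₀`) consumes.
[cite: Balaban1985Variational, (182) and (184) p.307, (188)–(190) p.308; Balaban1987RG1, (5.10) p.293] -/
theorem decay₂_eq182_of_eq184 {gt w d2h0 h0 h 𝔡 a0 : Kernel₂ d} {BG θW cΔ A₀ Ch Cd M₀ δ₀ : ℝ}
    (hgt : Decay₂ gt BG δ₀) (hw : Decay₂ w θW (δ₀ / 4)) (hd2 : Decay₂ d2h0 cΔ δ₀) (hh0 : Decay₂ h0 A₀ δ₀)
    (hh : Decay₂ h Ch δ₀) (hd : Decay₂ 𝔡 Cd δ₀)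
    (hδ₀ : 0 < δ₀) (hM₀ : ∀ x y, |a0 x y| ≤ M₀)
    (h184 : ∀ x y, a0 x y + compKer (compKer gt w) a0 x y = compKer gt d2h0 x y - compKer (compKer gt w) h0 x y)
    (hq : BG * θW * K₁ d (δ₀ - δ₀ / 4) * K₁ d (δ₀ / 4 - δ₀ / 8) < 1) :
    Decay₂ ((a0 + h0) + fun x y => (-1) * compKer h (compKer 𝔡 (a0 + h0)) x y)
      ((((BG * cΔ * K₁ d (δ₀ - δ₀ / 8) + BG * θW * K₁ d (δ₀ - δ₀ / 4) * A₀ * K₁ d (δ₀ / 4 - δ₀ / 8)) *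
          (1 - BG * θW * K₁ d (δ₀ - δ₀ / 4) * K₁ d (δ₀ / 4 - δ₀ / 8))⁻¹) + A₀) + |(-1 : ℝ)| *
        (Ch * (Cd * ((BG * cΔ * K₁ d (δ₀ - δ₀ / 8) + BG * θW * K₁ d (δ₀ - δ₀ / 4) * A₀ * K₁ d (δ₀ / 4 - δ₀ / 8)) *
          (1 - BG * θW * K₁ d (δ₀ - δ₀ / 4) * K₁ d (δ₀ / 4 - δ₀ / 8))⁻¹ + A₀) *
            ∑' v : Fin d → ℤ, Real.exp (-(δ₀ / 8 - δ₀ / 8 / 2) * l1 v)) *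
          ∑' v : Fin d → ℤ, Real.exp (-(δ₀ / 8 / 2 - δ₀ / 8 / 4) * l1 v)))
      (δ₀ / 8 / 4) :=
  decay₂_eq182 (decay₂_of_eq184 hgt hw hd2 hh0 hδ₀ hM₀ h184 hq) (decay₂_mono hh0 (by linarith))
    (decay₂_mono hh (by linarith)) (decay₂_mono hd (by linarith)) (by linarith)

end Literature.MathematicalPhysics.QuantumFieldTheory.Balaban1983to89.Beta.RemainderKernelNeumann
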